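import Literature.AlgebraicGeometry.GroupSchemes.BTGroupOneDimBlockNumerics   -- ★ p850272 twin of ED. 1 a47148020bfb350d (re-homed, director g27 s1336 (R1) ∕ LEAD «M-72»; Literature lane, namespace CHANGED to `Literature.AlgebraicGeometry.GroupSchemes.BTGroupOneDimBlockNumerics`; pen∕dealer LA7-plan (g4) #6)
import HarnessLib

/-! # F0_P6b_BlockNumerics — ED. 2 = SHIM (re-home, EXPORT + TWO KEPT ALIASES; CLASS II «K3», spine-upstream via `Lines/F0_P6d_BlockDocking.lean` → `F0_P6a_RGDAssembly` → MAIN).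
The «one-dimensional block numerics» line (ED. 1, sorry-free, 8 theorems) now lives in ★ `Literature/AlgebraicGeometry/GroupSchemes/BTGroupOneDimBlockNumerics.lean`
(p850272) with every SHORT name unchanged under the Literature namespace; this file re-serves the six ★ names under the OLD namespace
`Summit.HodgeConjecture.HodgeConjecture.Cruxes.HLiu418.F0P6bBlockNumerics` by `export` (aliases — `open …F0P6bBlockNumerics` + `blockNumerics_of_line …`, the one
use in `Lines/F0_P6d_BlockDocking.lean` :145, elaborates unchanged), and KEEPS as one-line alias theorems the two ED. 1 names the ★ twin dropped under `dedup.landed`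
(`N1b_unitComponentOfKernel` = ★ p845875 `BTGroup.exists_hom_kernel_app_one_of_unitComponent`, `N3_frobeniusIterateKills` = ★ p845869
`FrobKill.comp_relFrobeniusOver_comp_relFrobeniusOver_eq_one_of_algEquiv`; statements VERBATIM from ED. 1 :119–:136 ∕ :175–:187, 0 consumers today) so that EVERY ED. 1 FQN stays
resolvable BY NAME.  0 `sorry`, 0 socket, 0 new mathematics; edition history (skeleton cand v1 49deda72 → ED. 1) stays in the line card `Lines/F0_P6b_BlockNumerics.md` and in git.
HC_CM is proved only modulo the 7 printed citations (2 remaining named inputs hLiu418 = stmt-HodgeConjecture-24832, h413 = stmt-HodgeConjecture-24833) until rung 0 closes; count-neutral. -/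

set_option autoImplicit false

noncomputable section

namespace Summit.HodgeConjecture.HodgeConjecture.Cruxes.HLiu418.F0P6bBlockNumerics

set_option linter.dupNamespace false  -- `Summit.HodgeConjecture.HodgeConjecture.…` BY DESIGN (D-0017)

export Literature.AlgebraicGeometry.GroupSchemes.BTGroupOneDimBlockNumerics
  (N0_finrank_uniformizerKernel N1_unitComponentBTGroup N1c_tangentRankOfUnitComponent N2_exponentOfKernel N6_simplePoints
   blockNumerics_of_line)

open CategoryTheory CategoryTheory.Limits AlgebraicGeometry MonoidalCategory CartesianMonoidalCategory
open Polynomial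
open scoped MonObj Obj
open Literature.AlgebraicGeometry.Motives (SchemeOver specOver relFrobeniusOver frobeniusTwistOver)
open Literature.AlgebraicGeometry.GroupSchemes
open Literature.AlgebraicGeometry.GroupSchemes.AffineGroupScheme (Alg)
open Literature.AlgebraicGeometry.GroupSchemes.GroupSchemeKernel (ker kerι)

universe u v w

/-! ### Kept aliases (the two ED. 1 restatements the ★ twin does not carry; binder context = ED. 1's `variable` line after its `omit … in`) -/

section Aliases

variable {k : Type u} [Field k] (p f : ℕ)

/-- `N1b` (PAID ★ p845875 `UnitComponentOfKernel`, F0P6-p13) — **THE UNIT COMPONENT OF A KERNEL IS THE KERNEL ON THE UNIT COMPONENT**: for an endomorphism `φ` of `B` restricting to `φ₀`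
on a layer-`1` unit component `ι₀.app 1 : B₀.G 1 ↪ B.G 1`, the unit component `U` of `G = Ker (φ.app 1)` is carried isomorphically onto
`Ker (φ₀.app 1)`: the closed subgroup `Ker (φ.app 1) ∩ B₀.G 1` of the ONE-POINT scheme `B₀.G 1` has one point, is clopen in `G`, hence is `G⁰ = U`
(★ (o-c2d) `ConnectedFactorsThroughUnitComponent.existsUnique_fac_hom`, ★ `UnitComponentRank.range_eq_connectedComponent_of_unitComponent`).
PAID. [cite: Tate1997FiniteFlatGroupSchemes, (3.7)] [cite: SGA3I, VI_A 2.3–2.4] -/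
theorem N1b_unitComponentOfKernel {H H₀ : ℕ} (B : BTGroup (Spec (.of k)) p H) (B₀ : BTGroup (Spec (.of k)) p H₀)
    (ι₀ : BTGroup.Hom B₀ B)
    (hι₀ : IsOpenImmersion (ι₀.app 1).left ∧ IsClosedImmersion (ι₀.app 1).left ∧ ConnectedSpace ↥(B₀.G 1).left)
    (φ : BTGroup.Hom B B) (φ₀ : BTGroup.Hom B₀ B₀) (hφ : φ₀.comp ι₀ = ι₀.comp φ)
    (G : SchemeOver k) [GrpObj G] (ιG : G ⟶ B.G 1) (hιG : letI := B.grpObj 1; IsMonHom ιG ∧ IsClosedImmersion ιG.left)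
    (hker : letI := B.grpObj 1; ∀ ⦃T : SchemeOver k⦄ (t : T ⟶ B.G 1), t ≫ φ.app 1 = 1 ↔ ∃ s : T ⟶ G, s ≫ ιG = t)
    (U : SchemeOver k) [GrpObj U] (jU : U ⟶ G)
    (hU : IsMonHom jU ∧ IsOpenImmersion jU.left ∧ IsClosedImmersion jU.left ∧ ConnectedSpace ↥U.left) :
    ∃ u : U ⟶ B₀.G 1, (letI := B₀.grpObj 1; IsMonHom u ∧ IsClosedImmersion u.left) ∧ u ≫ ι₀.app 1 = jU ≫ ιG ∧
      (letI := B₀.grpObj 1; ∀ ⦃T : SchemeOver k⦄ (t : T ⟶ B₀.G 1), t ≫ φ₀.app 1 = 1 ↔ ∃ s : T ⟶ U, s ≫ u = t) :=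
  BTGroup.exists_hom_kernel_app_one_of_unitComponent p B B₀ ι₀ hι₀ φ φ₀ hφ G ιG hιG hker U jU hU

section N3

variable [ExpChar k p]

set_option synthInstance.maxHeartbeats 400000 in
/-- `N3` (PAID ★ p845869 `MonogenicSubgroupKilledByFrobeniusSquared`, B-p17) — **A MONOGENIC ONE-POINT CLOSED SUBGROUP OF EXPONENT `p^N`, `N ≤ 2f`, IS KILLED BY `F_q ≫ F_q` OF THE AMBIENT GROUP**:
`x^{p^N} = 0` for the generator `x` of the augmentation ideal of `Γ(U) ≃ κ̄[X]⧸(X^{p^N})`, so `F^{2f}_U = 1` (★ (FKw) `comp_relFrobeniusOver_eq_one_of_pow_mem_ker`,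
`ker_appTop_unit_eq_span_of_algEquiv`), which is `jU ≫ F^{2f}_G = 1` (★ K1 `comp_comp_relFrobeniusOver_eq_one_iff_unit`), which is the two-step form
(★ (K-c3) `comp_relFrobeniusOver_frobeniusTwistOver_eq_one_iff` ∕ naturality of `relFrobeniusOver` along `jU`, ★ `FrobKill.comp_relFrobeniusOver_comp_relFrobeniusOver_eq`).
PAID. [cite: SGA3I, VII_A 4.1–4.3] [cite: Demazure1972, Ch. II §5, §7] [cite: Tate1997FiniteFlatGroupSchemes, (3.7) (II)] -/
theorem N3_frobeniusIterateKills (G : SchemeOver k) [GrpObj G] [IsAffine G.left] [IsFinite G.hom]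
    (U : SchemeOver k) [GrpObj U] [IsAffine U.left] (jU : U ⟶ G)
    (hU : IsMonHom jU ∧ IsOpenImmersion jU.left ∧ IsClosedImmersion jU.left ∧ ConnectedSpace ↥U.left)
    {N : ℕ} (θU : (k[X] ⧸ Ideal.span {(X : k[X]) ^ (p ^ N)}) ≃ₐ[k] Alg U) (hN : N ≤ f + f) :
    jU ≫ relFrobeniusOver p f G ≫ relFrobeniusOver p f (frobeniusTwistOver p f G) = 1 :=
  FrobKill.comp_relFrobeniusOver_comp_relFrobeniusOver_eq_one_of_algEquiv p f G U jU hU θU hN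

end N3

end Aliases

end Summit.HodgeConjecture.HodgeConjecture.Cruxes.HLiu418.F0P6bBlockNumerics
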